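import Literature.AnabelianGeometry.EtaleTheta.ConstantsDictionaryWitnessSections
import Literature.AnabelianGeometry.EtaleTheta.Discharge.Sec5ConstantsDictionaryWitnessCompat
import Literature.AnabelianGeometry.EtaleTheta.Discharge.Sec5AutAmple
import HarnessLib

/-!
# [EtTh] §5: the FULL bundle `ThetaFrobenioid.Facts` is SATISFIABLE — binder-free at the constants-toy datum WITH SECTIONS
# (`CnstToy.datum′`), jointly with the Lemma 5.8 package and F-1306, over every theta setting's own §2 model and at `modelχ`

S. Mochizuki, *The étale theta function and its Frobenioid-theoretic manifestations*, Publ. RIMS **45** (2009) [MochizukiEtTh2009],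
§5 pp.330–331 (PDF pp.104–105) (the defining relations `s^⊓-gp_N(g) ∘ s^⊓_N = s^⊓_N ∘ (s^trv_N|…)(g)`, `s^⊔-gp_N(h) ∘ s^⊔_N = s^⊔_N ∘
(s^trv_N|…)(h)`; "`B_N` is Aut-ample"; [FrdI] Prop. 5.6 section `s^trv_N`), Prop. 4.3 (iii) p.317 (PDF p.91) (bi-Kummer cocycle), Lemma 5.8
p.331 (PDF p.105).

abc-iut cell, layer L2, seat abc-iut-w5-d013 (gen 6), row «CnstToy datum′ FULL-Facts NV» (abc-iut-L2-lead R562 (c) / R612 / R632 / R666 GO).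
PROOF-ONLY companion (0 definitions) of `ConstantsDictionaryWitnessSections.lean` (`CnstToy.datum′`).  abc-iut-L2-t11's `CnstToy.datum` files
(`ConstantsDictionaryWitness`, `Discharge/Sec5ConstantsDictionaryWitnessFacts`, `…Compat`) are consumed BY NAME; their theorems about `datum`
transport to `datum′` along the SHARED fields (everything but `s^trv_N`, `s^⊔-gp_N`) by definitional unfolding.  Nothing landed is edited.

RESULTS (namespace `ThetaFrobenioid.CnstToy`; `D` a theta setting, `Cu : E.DoubleUnderline l`, level `N`, `μ`, `hC`, `hS` as in L2-t11's files):
* THE OBSTRUCTION HALF (census pair, at L2-t11's `datum`): `strvSection_datum_iff` — with `s^trv_N := 1`, `StrvSection` holds IFF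
  `Aut_D(A_N^bs) = Γ` is trivial; `not_strvSection_datum_of_ne`, `not_facts_datum_of_ne` — so `datum` itself does NOT carry the full `Facts`
  whenever `Γ ≠ 1` (as its author labelled it);
* THE WITNESS HALF (at `datum′`): `baseIsoAB_datum'` (`(s^⊓_N)^bs = 𝟙`, so `Aut_D(A_N^bs) ⥲ Aut_D(B_N^bs)` is the identity:
  `autBaseIsoAB_datum'_apply` / `_symm_apply`), `sgpCapSpec_datum'`, `sgpCupSpec_datum'` (the two printed defining relations — with `s^⊓_N = s^⊔_N = 𝟙`
  they read `s^⊓-gp_N = s^trv_N`, `s^⊔-gp_N = s^trv_N|_{H_{B_N}}`), `strvSection_datum'` (`π ∘ inr = id` — L2-t11's `sgpCapSection_datum` verbatim),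
  `biKummerDifferenceMem_datum'` (difference cocycle `= 1 ∈ μ_N(B_N)`), `constantsActByCyclotome_datum'` (Lemma 5.8's arithmetic step — L2-t11's
  p456605 theorem transported), and **`facts_datum' : (datum′ Cu μ hC hS).Facts`** (all eight fields; `Epi (𝟙)` twice);
* transported Lemma 5.8 / junction package: `sgpCapSection_datum'`, `kxRootNModCyclotome_datum'`, `invariantUnitsEqConstants_datum'`,
  `kxOuterActionExtends_datum'`, `cyclotomicCharacterCompatX_datum'` (FACT row F-1306 with `ι := refl`, `m := muEquiv`), `identifiesPiY_datum'`,
  `identifiesPiYdd_datum'`; hence, from the bundle, Lemma 5.8 `constantsEqNormalizer`, Lemma 5.9 (i) `sectionsFactor`, (ii) `enExact`, the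
  sections of `s^⊓-gp_N`/`s^⊔-gp_N` and `sgpUnique` (`Facts.*`, abc-iut-L2-t4) all hold at `datum′`;
* CENSUS FORMS: `exists_facts` (over `(B(μ_N(J_N) ⋊ Γ), BΓ)` with `Π^tp_X̲ = T.PiX`: `Facts ∧ KxRootNModCyclotome ∧ InvariantUnitsEqConstants ∧
  KxOuterActionExtends`), `exists_facts_cyclotomicCharacterCompatX` (`Facts ∧` F-1306 `∧ KxRootNModCyclotome ∧ IdentifiesPiY ∧ IdentifiesPiYdd` at
  ONE datum), **`exists_facts_modelχ`** — binder-free AT THE RECORD MODEL `modelχ p` (abc-iut-L2-d1's `doubleUnderlineχSec`, abc-iut-L2-t8's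
  `modelχ_sec2Hyps` / `modelχ_nonempty_cyclotomeMod` BY NAME): for every prime `p`, odd `l`, level `N`, `Facts ∧ KxRootNModCyclotome ∧` F-1306.
K4 note (c312-2 CONE-K4-RECLOSE v4): FACT row F-2494 `Facts` is bound at EtTh:Lem5.8 / Lem5.9 (i)–(iv) / Prop5.2 (iii) with 0/n INHABITED; this file is
JOINT-CONSISTENCY evidence for that bundle at a TOY datum, not genuine-carrier currency.
HONEST LABEL: `datum′` is a toy (NOT the tempered Frobenioid of a curve: trivial divisor monoids, `A_⊚ = A_N = B_N`, `Θ̈ = 1`, trivial bi-Kummer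
difference cocycle) and `modelχ` is a semi-synthetic model of the typed §1 interface — consistency / non-vacuity evidence only; nothing of [EtTh] is
asserted; typed ≠ proved; no side is taken on anything downstream ([IUTchIII] Cor. 3.12).
-/

noncomputable section

namespace Literature.AnabelianGeometry.EtaleTheta

open CategoryTheory Literature.AnabelianGeometry.SemiGraphs IntermediateField

namespace ThetaFrobenioid

namespace CnstToy

variable {p : ℕ} [Fact p.Prime] {D : ThetaSetting p} {N : ℕ+} {E : D.EtaleThetaData} {l : ℕ}
  (Cu : E.DoubleUnderline l) (μ : D.CyclotomeMod l N) (hC : D.Compat) (hS : D.Sec2Hyps)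

/-! ### The obstruction half: with `s^trv_N := 1`, `StrvSection` forces `Γ = 1` -/

/-- **At abc-iut-L2-t11's `datum` (`s^trv_N := 1`), `StrvSection` («`(s^trv_N(g))^bs = g` for all `g ∈ Aut_D(A_N^bs)`», [FrdI] Prop. 5.6) holds
IFF `Aut_D(A_N^bs) = Γ` is trivial** — the honest obstruction recorded by its author («the full bundle `Facts` [is] NOT claimed here»).
[cite: MochizukiEtTh2009, §5 p.330 (PDF p.104)] -/
theorem strvSection_datum_iff :
    (datum Cu μ hC hS).StrvSection ↔ ∀ g : Aut ((datum Cu μ hC hS).base.obj (datum Cu μ hC hS).AN), g = 1 := by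
  constructor
  · intro h g
    have hg := h g
    rw [show (datum Cu μ hC hS).strv g = 1 from rfl, map_one] at hg
    exact hg.symm
  · intro h g
    rw [show (datum Cu μ hC hS).strv g = 1 from rfl, map_one]
    exact (h g).symm

/-- `StrvSection` FAILS at `datum` as soon as `Γ` has a non-trivial element. [cite: MochizukiEtTh2009, §5 p.330 (PDF p.104)] -/
theorem not_strvSection_datum_of_ne (g : Aut ((datum Cu μ hC hS).base.obj (datum Cu μ hC hS).AN)) (hg : g ≠ 1) :
    ¬ (datum Cu μ hC hS).StrvSection := fun h =>
  hg ((strvSection_datum_iff Cu μ hC hS).mp h g)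

/-- Hence the FULL bundle `Facts` fails at `datum` as soon as `Γ ≠ 1` (its `strvSection` field).
[cite: MochizukiEtTh2009, §5 p.330–331 (PDF pp.104–105)] -/
theorem not_facts_datum_of_ne (g : Aut ((datum Cu μ hC hS).base.obj (datum Cu μ hC hS).AN)) (hg : g ≠ 1) :
    ¬ (datum Cu μ hC hS).Facts := fun H =>
  not_strvSection_datum_of_ne Cu μ hC hS g hg H.strvSection

/-! ### The witness half: the sections of `datum′` and its `Facts` -/

/-- `(s^⊓-gp_N(g))^bs = g` at `datum′` (shared field: abc-iut-L2-t11's `sgpCapSection_datum` verbatim). [cite: MochizukiEtTh2009, §5 p.331 (PDF p.105)] -/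
theorem sgpCapSection_datum' : (datum' Cu μ hC hS).SgpCapSection := sgpCapSection_datum Cu μ hC hS

/-- **`StrvSection` at `datum′`** («`(s^trv_N(g))^bs = g`»; [FrdI] Prop. 5.6): `s^trv_N = inr` and `π ∘ inr = id` — the same computation as
`sgpCapSection_datum` (`A_N = B_N`, `s^trv_N = s^⊓-gp_N`).  [cite: MochizukiEtTh2009, §5 p.330 (PDF p.104)] -/
theorem strvSection_datum' : (datum' Cu μ hC hS).StrvSection := sgpCapSection_datum Cu μ hC hS

/-- **Lemma 5.8's arithmetic step `ConstantsActByCyclotome` at `datum′`** — abc-iut-L2-t11's p456605 theorem for `datum`, transported (the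
predicate only reads `s^⊓-gp_N`, `ρ`, the units and the constants, all shared).  [cite: MochizukiEtTh2009, Lem 5.8 p.331 (PDF p.105)] -/
theorem constantsActByCyclotome_datum' : (datum' Cu μ hC hS).ConstantsActByCyclotome :=
  constantsActByCyclotome_datum Cu μ hC hS

/-- Lemma 5.8 «`(K^×)^{1/N}/μ_N(B_N) (⥲ K^×)`» (`KxRootNModCyclotome`) at `datum′`, transported. [cite: MochizukiEtTh2009, Lem 5.8 p.331 (PDF p.105)] -/
theorem kxRootNModCyclotome_datum' : (datum' Cu μ hC hS).KxRootNModCyclotome :=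
  kxRootNModCyclotome_datum Cu μ hC hS

/-- abc-iut-w4-d095's «`(O^×(B_N))^{Π^tp_Y} = O_K^×`» (`InvariantUnitsEqConstants`) at `datum′`, transported.
[cite: MochizukiEtTh2009, Lem 5.8 proof p.331 (PDF p.105)] -/
theorem invariantUnitsEqConstants_datum' : (datum' Cu μ hC hS).InvariantUnitsEqConstants :=
  invariantUnitsEqConstants_datum Cu μ hC hS

/-- Lemma 5.8 «this outer action extends to an outer action of `(K^×)^{1/N}/μ_N(B_N) (⥲ K^×)` on `E_N`» (`KxOuterActionExtends`) at
`datum′`, transported (`E_N` reads only `s^⊓-gp_N`, `Im(Π^tp_Y̲)`, `μ_N(B_N)`).  [cite: MochizukiEtTh2009, Lem 5.8 p.331 (PDF p.105)] -/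
theorem kxOuterActionExtends_datum' : (datum' Cu μ hC hS).KxOuterActionExtends :=
  kxOuterActionExtends_datum Cu μ hC hS

/-- `IdentifiesPiY` at `datum′` with `ι := refl` (`Π^tp_Y̲ = Ker(Π^tp_X̲ ↠ ℤ) = T.PiY`). [cite: MochizukiEtTh2009, Lem 5.9 (iv) p.332 (PDF p.106)] -/
theorem identifiesPiY_datum' :
    (datum' Cu μ hC hS).IdentifiesPiY (Cu.thetaEnvData μ hC hS) (MulEquiv.refl _) :=
  identifiesPiY_datum Cu μ hC hS

/-- `IdentifiesPiYdd` at `datum′` with `ι := refl`. [cite: MochizukiEtTh2009, Lem 5.9 (iv) p.332 (PDF p.106)] -/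
theorem identifiesPiYdd_datum' :
    (datum' Cu μ hC hS).IdentifiesPiYdd (Cu.thetaEnvData μ hC hS) (MulEquiv.refl _) :=
  fun _ => Iff.rfl

/-- **FACT row F-1306 `CyclotomicCharacterCompatX` at `datum′`** (`ι := refl`, `m := muEquiv`): conjugation by `s^⊓-gp_N(ρ g)` on `μ_N(B_N) =
μ_N(J_N)` IS the Galois action of `aug(g)`, i.e. the mod-`N` cyclotomic character — abc-iut-L2-t11's `cyclotomicCharacterCompatX_datum`,
transported.  [cite: MochizukiEtTh2009, Lem 5.8 proof p.331 (PDF p.105)] -/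
theorem cyclotomicCharacterCompatX_datum' :
    (datum' Cu μ hC hS).CyclotomicCharacterCompatX (Cu.thetaEnvData μ hC hS)
      (ContinuousMulEquiv.refl (datum' Cu μ hC hS).PiX).toMulEquiv (muEquiv Cu μ hC hS) :=
  cyclotomicCharacterCompatX_datum Cu μ hC hS

/-- **`(s^⊓_N)^bs : A_N^bs ⥲ B_N^bs` of `datum′` is the identity** (`s^⊓_N = 𝟙 ⋆`). [cite: MochizukiEtTh2009, §5 p.331 (PDF p.105)] -/
theorem baseIsoAB_datum' : (datum' Cu μ hC hS).baseIsoAB = Iso.refl _ := by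
  apply Iso.ext
  exact (datum' Cu μ hC hS).base.map_id _

/-- Hence «the isomorphism `Aut_D(A_N^bs) ⥲ Aut_D(B_N^bs)` determined by … `s^⊓_N, s^⊔_N`» (conjugation by `(s^⊓_N)^bs`) is the identity at
`datum′`.  [cite: MochizukiEtTh2009, §5 p.331 (PDF p.105)] -/
theorem autBaseIsoAB_datum'_apply (g : Aut ((datum' Cu μ hC hS).base.obj (datum' Cu μ hC hS).AN)) :
    (datum' Cu μ hC hS).autBaseIsoAB g = g := by
  apply Aut.ext
  change ((datum' Cu μ hC hS).baseIsoAB.conjAut g).hom = g.hom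
  rw [baseIsoAB_datum', Iso.conjAut_hom]
  exact Iso.refl_conj _

/-- The inverse direction: `(Aut_D(A_N^bs) ⥲ Aut_D(B_N^bs))⁻¹(g) = g` at `datum′`. [cite: MochizukiEtTh2009, §5 p.331 (PDF p.105)] -/
theorem autBaseIsoAB_datum'_symm_apply (g : Aut ((datum' Cu μ hC hS).base.obj (datum' Cu μ hC hS).BN)) :
    ((datum' Cu μ hC hS).autBaseIsoAB.symm g : Aut ((datum' Cu μ hC hS).base.obj (datum' Cu μ hC hS).BN)) = g := by
  have h := autBaseIsoAB_datum'_apply Cu μ hC hS ((datum' Cu μ hC hS).autBaseIsoAB.symm g)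
  rw [MulEquiv.apply_symm_apply] at h
  exact h.symm

/-- **The defining relation of `s^⊓-gp_N`** (p.331: «`s^⊓-gp_N(g) ∘ s^⊓_N = s^⊓_N ∘ (s^trv_N|…)(g)` for all `g ∈ Aut_D(B_N^bs)`»; abc-iut-L2-t4's
`SgpCapSpec`) **HOLDS at `datum′`**: with `s^⊓_N = 𝟙` it reads `s^⊓-gp_N(g) = s^trv_N(g)`, true by construction (`inr = inr`).
[cite: MochizukiEtTh2009, §5 p.331 (PDF p.105)] -/
theorem sgpCapSpec_datum' : (datum' Cu μ hC hS).SgpCapSpec := by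
  intro g
  rw [autBaseIsoAB_datum'_symm_apply]
  change 𝟙 _ ≫ (sgpCap (D := D) (N := N) g).hom = (sgpCap (D := D) (N := N) g).hom ≫ 𝟙 _
  rw [Category.id_comp, Category.comp_id]

/-- **The defining relation of `s^⊔-gp_N`** (p.331: «`s^⊔-gp_N(h) ∘ s^⊔_N = s^⊔_N ∘ (s^trv_N|_{H_{B_N}})(h)` for all `h ∈ H_{B_N}`»; abc-iut-L2-t4's
`SgpCupSpec`) **HOLDS at `datum′`**: with `s^⊔_N = s^⊓_N = 𝟙` and `s^⊔-gp_N = inr|_{H_{B_N}}` it is the previous relation at `h`.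
[cite: MochizukiEtTh2009, §5 p.331 (PDF p.105)] -/
theorem sgpCupSpec_datum' : (datum' Cu μ hC hS).SgpCupSpec := fun h =>
  sgpCapSpec_datum' Cu μ hC hS (h : Aut ((datum' Cu μ hC hS).base.obj (datum' Cu μ hC hS).BN))

/-- **The bi-Kummer difference cocycle of `datum′` is `μ_N(B_N)`-valued** (Prop. 4.3 (iii), abc-iut-L2-t4's `BiKummerDifferenceMem`) — indeed
TRIVIAL: `s^⊔-gp_N(h) · s^⊓-gp_N(h)⁻¹ = 1` (the toy has `Θ̈ := 1`).  [cite: MochizukiEtTh2009, Prop 4.3 (iii) p.317 (PDF p.91)] -/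
theorem biKummerDifferenceMem_datum' : (datum' Cu μ hC hS).BiKummerDifferenceMem := by
  intro h
  change sgpCap (D := D) (N := N) h.1 * (sgpCap (D := D) (N := N) h.1)⁻¹ ∈ _
  rw [mul_inv_cancel]
  exact Subgroup.one_mem _

/-- **THE FULL BUNDLE `ThetaFrobenioid.Facts` HOLDS AT `datum′`, binder-free** (all eight fields: the two defining relations of p.331, the section
`s^trv_N` of [FrdI] Prop. 5.6, the bi-Kummer cocycle of Prop. 4.3 (iii), Aut-ampleness of `B_N` (p.330), Lemma 5.8's arithmetic step, and total
epimorphicity at `s^⊓_N = s^⊔_N = 𝟙`) — over EVERY theta setting's own §2 model `Cu.thetaEnvData μ hC hS`.  TOY; consistency evidence only.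
[cite: MochizukiEtTh2009, §5 pp.330–331 (PDF pp.104–105)] -/
theorem facts_datum' : (datum' Cu μ hC hS).Facts :=
  Facts.of _ (sgpCapSpec_datum' Cu μ hC hS) (sgpCupSpec_datum' Cu μ hC hS) (strvSection_datum' Cu μ hC hS)
    (biKummerDifferenceMem_datum' Cu μ hC hS) (constantsActByCyclotome_datum' Cu μ hC hS)
    (by change Epi (𝟙 _); infer_instance) (by change Epi (𝟙 _); infer_instance)

/-- From the bundle (abc-iut-L2-t4's `Facts.*`): Lemma 5.8 `ConstantsEqNormalizer`, Lemma 5.9 (i) `SectionsFactor`, (ii) `ENExact`, the section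
`SgpCupSection` and the uniqueness `SgpUnique` all hold at `datum′`.  [cite: MochizukiEtTh2009, Lem 5.8 p.331, Lem 5.9 (i)(ii) p.331–332 (PDF pp.105–106)] -/
theorem lemma58_59_datum' :
    (datum' Cu μ hC hS).ConstantsEqNormalizer ∧ (datum' Cu μ hC hS).SectionsFactor ∧ (datum' Cu μ hC hS).ENExact ∧
      (datum' Cu μ hC hS).SgpCupSection ∧ (datum' Cu μ hC hS).SgpUnique :=
  ⟨(facts_datum' Cu μ hC hS).constantsEqNormalizer, (facts_datum' Cu μ hC hS).sectionsFactor, (facts_datum' Cu μ hC hS).enExact,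
    (facts_datum' Cu μ hC hS).sgpCupSection, (facts_datum' Cu μ hC hS).sgpUnique⟩

/-! ### Census forms -/

/-- **Census form (binders = the construction data only)**: over `(B(μ_N(J_N) ⋊ Γ), BΓ)` there EXISTS a §5 datum with `Π^tp_X̲ = T.PiX`
(`T := Cu.thetaEnvData μ hC hS`) satisfying the FULL `Facts` bundle TOGETHER WITH Lemma 5.8's `KxRootNModCyclotome`, `InvariantUnitsEqConstants`
and `KxOuterActionExtends`.  [cite: MochizukiEtTh2009, §5 pp.330–331 (PDF pp.104–105); Lem 5.8 p.331 (PDF p.105)] -/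
theorem exists_facts :
    ∃ 𝔉 : ThetaFrobenioid.{0} (SingleObj (G D N)) (SingleObj (Gam D N)),
      𝔉.Facts ∧ 𝔉.KxRootNModCyclotome ∧ 𝔉.InvariantUnitsEqConstants ∧ 𝔉.KxOuterActionExtends ∧
        𝔉.PiX = (Cu.thetaEnvData μ hC hS).PiX :=
  ⟨datum' Cu μ hC hS, facts_datum' Cu μ hC hS, kxRootNModCyclotome_datum' Cu μ hC hS,
    invariantUnitsEqConstants_datum' Cu μ hC hS, kxOuterActionExtends_datum' Cu μ hC hS, rfl⟩

/-- **Census form, joint with F-1306 and the junction identifications**: at ONE §5 datum over the setting's own §2 model (namely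
`datum′ Cu μ hC hS`) there exist `ι`, `m` with `Facts ∧ CyclotomicCharacterCompatX ∧ KxRootNModCyclotome ∧ IdentifiesPiY ∧ IdentifiesPiYdd`.
[cite: MochizukiEtTh2009, Lem 5.8 p.331 (PDF p.105); Lem 5.9 (iv) p.332 (PDF p.106)] -/
theorem exists_facts_cyclotomicCharacterCompatX :
    ∃ (ι : (datum' Cu μ hC hS).PiX ≃ₜ* (Cu.thetaEnvData μ hC hS).PiX)
      (m : (datum' Cu μ hC hS).muTorsion (datum' Cu μ hC hS).BN (datum' Cu μ hC hS).N ≃* (Cu.thetaEnvData μ hC hS).mu),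
      (datum' Cu μ hC hS).Facts ∧
      (datum' Cu μ hC hS).CyclotomicCharacterCompatX (Cu.thetaEnvData μ hC hS) ι.toMulEquiv m ∧
        (datum' Cu μ hC hS).KxRootNModCyclotome ∧ (datum' Cu μ hC hS).IdentifiesPiY (Cu.thetaEnvData μ hC hS) ι.toMulEquiv ∧
        (datum' Cu μ hC hS).IdentifiesPiYdd (Cu.thetaEnvData μ hC hS) ι.toMulEquiv :=
  ⟨_, _, facts_datum' Cu μ hC hS, cyclotomicCharacterCompatX_datum' Cu μ hC hS, kxRootNModCyclotome_datum' Cu μ hC hS,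
    identifiesPiY_datum' Cu μ hC hS, identifiesPiYdd_datum' Cu μ hC hS⟩

/-- **Census form AT THE χ-TWISTED RECORD MODEL `modelχ p`, binder-free**: for every prime `p`, odd `l` and level `N`, with abc-iut-L2-d1's
choice `X̲̲ := doubleUnderlineχSec p l hl`, abc-iut-L2-t8's cyclotome identification (`modelχ_nonempty_cyclotomeMod`) and §1/§2 hypotheses
(`modelχ_sec2Hyps`), the §5 datum `datum′` over the record model's mono-theta environment satisfies the FULL `Facts` bundle, Lemma 5.8's
`KxRootNModCyclotome` and F-1306 `CyclotomicCharacterCompatX` (`ι := refl`, `m := muEquiv`).  HONEST LABEL: `modelχ` is a semi-synthetic model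
of the typed §1 interface and the §5 datum is a toy; consistency evidence only.  [cite: MochizukiEtTh2009, §5 pp.330–331 (PDF pp.104–105)] -/
theorem exists_facts_modelχ (p : ℕ) [Fact p.Prime] (l : ℕ+) (hl : Odd (l : ℕ)) (N : ℕ+) :
    ∃ (μ : (ThetaSetting.modelχ p).CyclotomeMod l N),
      (datum' (SettingModel.doubleUnderlineχSec p l hl) μ (ThetaSetting.modelχ_sec2Hyps p).compat
        (ThetaSetting.modelχ_sec2Hyps p)).Facts ∧
      (datum' (SettingModel.doubleUnderlineχSec p l hl) μ (ThetaSetting.modelχ_sec2Hyps p).compat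
        (ThetaSetting.modelχ_sec2Hyps p)).KxRootNModCyclotome ∧
      (datum' (SettingModel.doubleUnderlineχSec p l hl) μ (ThetaSetting.modelχ_sec2Hyps p).compat
        (ThetaSetting.modelχ_sec2Hyps p)).CyclotomicCharacterCompatX
        ((SettingModel.doubleUnderlineχSec p l hl).thetaEnvData μ (ThetaSetting.modelχ_sec2Hyps p).compat
          (ThetaSetting.modelχ_sec2Hyps p)) (MulEquiv.refl _)
        (muEquiv (SettingModel.doubleUnderlineχSec p l hl) μ (ThetaSetting.modelχ_sec2Hyps p).compat
          (ThetaSetting.modelχ_sec2Hyps p)) := by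
  obtain ⟨μ⟩ := SettingModel.modelχ_nonempty_cyclotomeMod p l.pos N
  exact ⟨μ, facts_datum' _ μ _ _, kxRootNModCyclotome_datum' _ μ _ _, cyclotomicCharacterCompatX_datum' _ μ _ _⟩

end CnstToy

end ThetaFrobenioid

end Literature.AnabelianGeometry.EtaleTheta

end
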